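import Literature.Analysis.Calculus.LogCutoff
import Summits.AnomalousDissipation.AnomalousDissipation.Theorems.SawtoothPulseCascadeK1LocalisedCascadeLedgerGeometric
import Summits.AnomalousDissipation.AnomalousDissipation.Theorems.SawtoothPulseCascadeK1LocalisedCascadeConcreteStepV
import Summits.AnomalousDissipation.AnomalousDissipation.Theorems.SawtoothPulseCascadeK1LocalisedCascadeLedgerCascadeH

/-!
# K1loc, line `Spectral` / SeqCone — helper: THE V HALF-SLOTS OF THE CASCADE LEDGER DECAY GEOMETRICALLY (S-B assembly)

Helper file of the prover lane on the crux `K1LocalisedCascade` (stmt-AnomalousDissipation-19491), route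
`SawtoothPulseCascade` (S-B/S-C assembly seat).  V twin of `…LedgerCascadeH`: for the concrete cascade at the crux point
(`N₀ = 1`, `ρN = 2`, `d = 2`; `5 ≤ γ ≤ 8`, `0 < δ₀ ≤ 1/4`) and the tracked product-symbol family along the schedule of
`…LedgerSchedule` / `…LedgerCutoffSchedule`, this file instantiates `…K1Ledger.cascade_ledger_step_V_concrete` at every
phase (old symbol `μⱽ_j = m̂_j`, new symbol `μᴴ_{j+1} = μ̂_{j+1}`; V fibre scale `b^V_j = L_j/(20(γ²+29/20)(1+1/250))`;
V symbol socket `…SymbolSocketV`) and majorises its explicit errors (`…LedgerMajorantsSum`, envelope constant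
`c = (3γ+5)L₀/1000`): **`exists_geometric_hstepV`** — there are `K_ε, K_ζ ≥ 0` such that for every `0 < κ ≤ 1`, every
classical cascade scalar `w` from `θ₀` (`|θ₀| ≤ B`) and every phase `j < J_{γ²−3}(κ)` the V half-slot inequality
`‖μᴴ_{j+1}(D)w(tStart (j+1))‖² ≤ (‖μⱽ_j(D)w(tStart j + tHalf j)‖ + ε)² + ζ` holds with `ε ≤ K_ε θ^j`, `ζ ≤ K_ζ θ^j`,
`θ = (max(16/ρ, 1/2))^{1/4} < 1` — literally `hstepV` of `…K1Ledger.highModeConcentration_of_geometric_ledger'` (with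
`i₀ = 0`).  No definitions; no statement about the stub.
[cite: ElgindiLissMattingly2025, §1.2.1–§1.2.2 and §3.1] [cite: BedrossianCotiZelati2017, §2] [problem: turb]
-/

-- `Summit.<Summit>.<Problem>`: single-conjunct summit, the duplicate namespace segment is deliberate.
set_option linter.dupNamespace false

noncomputable section

namespace Summit.AnomalousDissipation.AnomalousDissipation.Theorems.SawtoothPulseCascade.K1Ledger

open MeasureTheory Set Filter Topology UnitAddTorus Function
open Literature.Analysis Literature.Analysis.FunctionSpaces Literature.Analysis.FunctionSpaces.Torus
open Literature.Analysis.FluidPDE.SawtoothCascade Literature.Analysis.FluidPDE.SawtoothCascade.CascadeParams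
open Summit.AnomalousDissipation.AnomalousDissipation.Theorems.SawtoothPulseCascade.K1Symbol

section Cascade

variable (P : CascadeParams)

set_option maxHeartbeats 400000 in
/-- **The V half-slots of the cascade ledger decay geometrically.**  See the module docstring.
[cite: ElgindiLissMattingly2025, §1.2.1–§1.2.2 and §3.1] [cite: BedrossianCotiZelati2017, §2] -/
theorem exists_geometric_hstepV (hγ : 5 ≤ P.γ) (hγ' : P.γ ≤ 8) (hδ₀ : 0 < P.δ₀) (hδ₀' : P.δ₀ ≤ 1 / 4)
    (hd : P.d = 2) (hN₀ : P.N₀ = 1) (hρN : P.ρN = 2) {L₀ : ℝ} (hL₀ : 1000 ≤ L₀)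
    {θ₀ : UnitAddTorus (Fin 2) → ℝ} {B : ℝ} (hB : ∀ x, |θ₀ x| ≤ B) :
    ∃ Kε Kζ : ℝ, 0 ≤ Kε ∧ 0 ≤ Kζ ∧ ∀ κ ∈ Ioc (0 : ℝ) 1, ∀ w : ℝ → UnitAddTorus (Fin 2) → ℝ,
      FluidPDE.Torus.IsClassicalScalarTransportOn (Ico 0 1) κ P.field w → w 0 = θ₀ →
        ∀ j : ℕ, 0 ≤ j → j < Jrate (P.γ ^ 2 - 3) κ → ∃ ε ζ : ℝ, 0 ≤ ε ∧
          ε ≤ Kε * Real.sqrt (Real.sqrt (max (16 / ((P.γ ^ 2 - 5 / 2) / (1 + 1 / 250) ^ 2 - 1 / (2 * (1 + 1 / 250) * L₀))) (1 / 2))) ^ j ∧ 0 ≤ ζ ∧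
          ζ ≤ Kζ * Real.sqrt (Real.sqrt (max (16 / ((P.γ ^ 2 - 5 / 2) / (1 + 1 / 250) ^ 2 - 1 / (2 * (1 + 1 / 250) * L₀))) (1 / 2))) ^ j ∧
          ∑' k : Fin 2 → ℤ, (1 - Real.smoothTransition ((|((k 0 : ℤ) : ℝ)| - L₀ * ((P.γ ^ 2 - 5 / 2) / (1 + 1 / 250) ^ 2 - 1 / (2 * (1 + 1 / 250) * L₀)) ^ (j + 1)) /
            (1 / 250 * (L₀ * ((P.γ ^ 2 - 5 / 2) / (1 + 1 / 250) ^ 2 - 1 / (2 * (1 + 1 / 250) * L₀)) ^ (j + 1)))) *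
          (1 - Real.smoothTransition ((P.γ * |((k 1 : ℤ) : ℝ)| - 13 / 10 * |((k 0 : ℤ) : ℝ)|) /
            (1 / 20 * (L₀ * ((P.γ ^ 2 - 5 / 2) / (1 + 1 / 250) ^ 2 - 1 / (2 * (1 + 1 / 250) * L₀)) ^ (j + 1))))) *
        ((1 - Real.smoothTransition ((|((k 0 : ℤ) : ℝ)| - 2 * L₀ * ((1 + P.γ) ^ 2 + 1) ^ (j + 1)) /
            (L₀ * ((P.γ ^ 2 - 5 / 2) / (1 + 1 / 250) ^ 2 - 1 / (2 * (1 + 1 / 250) * L₀)) ^ (j + 1) / (20 * P.γ * (1 + 1 / 250))))) *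
          (1 - Real.smoothTransition ((|((k 1 : ℤ) : ℝ)| - 2 * L₀ * ((1 + P.γ) ^ 2 + 1) ^ (j + 1)) /
            (L₀ * ((P.γ ^ 2 - 5 / 2) / (1 + 1 / 250) ^ 2 - 1 / (2 * (1 + 1 / 250) * L₀)) ^ (j + 1) / (20 * P.γ * (1 + 1 / 250)))))))
              ^ 2 * ‖mFourierCoeff (fun x => (w (tStart (j + 1)) x : ℂ)) k‖ ^ 2 ≤
            (Real.sqrt (∑' k : Fin 2 → ℤ, (1 - Real.smoothTransition ((|((k 0 : ℤ) : ℝ)| -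
              L₀ * ((P.γ ^ 2 - 5 / 2) / (1 + 1 / 250) ^ 2 - 1 / (2 * (1 + 1 / 250) * L₀)) ^ j / (1 + 1 / 250)) /
            (1 / 250 * (L₀ * ((P.γ ^ 2 - 5 / 2) / (1 + 1 / 250) ^ 2 - 1 / (2 * (1 + 1 / 250) * L₀)) ^ j / (1 + 1 / 250)))) *
          (1 - Real.smoothTransition ((P.γ * |((k 1 : ℤ) : ℝ) + P.γ * ((k 0 : ℤ) : ℝ)| - 29 / 20 * |((k 0 : ℤ) : ℝ)|) /
              (1 / 20 * (L₀ * ((P.γ ^ 2 - 5 / 2) / (1 + 1 / 250) ^ 2 - 1 / (2 * (1 + 1 / 250) * L₀)) ^ j / (1 + 1 / 250)))) *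
            Real.smoothTransition ((P.γ * |((k 1 : ℤ) : ℝ) - P.γ * ((k 0 : ℤ) : ℝ)| - 29 / 20 * |((k 0 : ℤ) : ℝ)|) /
              (1 / 20 * (L₀ * ((P.γ ^ 2 - 5 / 2) / (1 + 1 / 250) ^ 2 - 1 / (2 * (1 + 1 / 250) * L₀)) ^ j / (1 + 1 / 250))))) *
        ((1 - Real.smoothTransition ((|((k 0 : ℤ) : ℝ)| -
              ((1 + P.γ) * (2 * L₀ * ((1 + P.γ) ^ 2 + 1) ^ j +
                L₀ * ((P.γ ^ 2 - 5 / 2) / (1 + 1 / 250) ^ 2 - 1 / (2 * (1 + 1 / 250) * L₀)) ^ j / (20 * P.γ * (1 + 1 / 250))) +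
                1 / 2)) /
            (L₀ * ((P.γ ^ 2 - 5 / 2) / (1 + 1 / 250) ^ 2 - 1 / (2 * (1 + 1 / 250) * L₀)) ^ j / (20 * P.γ * (1 + 1 / 250))))) *
          (1 - Real.smoothTransition ((|((k 1 : ℤ) : ℝ)| -
              ((1 + P.γ) * (2 * L₀ * ((1 + P.γ) ^ 2 + 1) ^ j +
                L₀ * ((P.γ ^ 2 - 5 / 2) / (1 + 1 / 250) ^ 2 - 1 / (2 * (1 + 1 / 250) * L₀)) ^ j / (20 * P.γ * (1 + 1 / 250))) +
                1 / 2)) /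
            (L₀ * ((P.γ ^ 2 - 5 / 2) / (1 + 1 / 250) ^ 2 - 1 / (2 * (1 + 1 / 250) * L₀)) ^ j / (20 * P.γ * (1 + 1 / 250)))))))
                ^ 2 * ‖mFourierCoeff (fun x => (w (tStart j + tHalf j) x : ℂ)) k‖ ^ 2) + ε) ^ 2 + ζ := by
  -- elementary facts
  have hγ0 : 0 < P.γ := by linarith
  have hγ1 : 1 ≤ P.γ := by linarith
  have hγb : 0 < P.γ ^ 2 + 29 / 20 := by positivity
  have hL0 : 0 < L₀ := by linarith
  have hd0 : 0 < P.d := by rw [hd]; norm_num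
  have hr1 : 1 < (P.γ ^ 2 - 3) := one_lt_rate hγ
  have hrρ : (P.γ ^ 2 - 3) < ((P.γ ^ 2 - 5 / 2) / (1 + 1 / 250) ^ 2 - 1 / (2 * (1 + 1 / 250) * L₀)) := rate_lt_rho hγ hγ' hL₀
  have hρ0 : 0 < ((P.γ ^ 2 - 5 / 2) / (1 + 1 / 250) ^ 2 - 1 / (2 * (1 + 1 / 250) * L₀)) := rho_pos hγ hγ' hL₀
  have hr22 : (22 : ℝ) ≤ (P.γ ^ 2 - 3) := by nlinarith
  have hρ16 : 16 < ((P.γ ^ 2 - 5 / 2) / (1 + 1 / 250) ^ 2 - 1 / (2 * (1 + 1 / 250) * L₀)) := by linarith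
  have hρr2 : ((P.γ ^ 2 - 5 / 2) / (1 + 1 / 250) ^ 2 - 1 / (2 * (1 + 1 / 250) * L₀)) ≤ (P.γ ^ 2 - 3) ^ 2 := by
    have h1 := rho_le_lambda (γ := P.γ) hL₀
    have h2 : (P.γ ^ 2 - 5 / 2) / (1 + 1 / 250) ^ 2 ≤ P.γ ^ 2 - 5 / 2 := div_le_self (by nlinarith) (by norm_num)
    nlinarith
  have hG2 : 2 ≤ ((1 + P.γ) ^ 2 + 1) := by nlinarith
  have hG1 : 1 ≤ ((1 + P.γ) ^ 2 + 1) := by linarith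
  obtain ⟨hΘ16, hΘhalf⟩ := le_theta0_sq ((P.γ ^ 2 - 5 / 2) / (1 + 1 / 250) ^ 2 - 1 / (2 * (1 + 1 / 250) * L₀))
  obtain ⟨hΘpos, hΘlt1⟩ := theta0_pos_lt_one hρ16
  obtain ⟨hΘθ, hθ1, hθ0⟩ := theta_facts hρ16
  have hMb0 : 0 ≤ Real.sqrt (2 * Real.log (2000 * ((1 + P.γ) ^ 2 + 1))) := Real.sqrt_nonneg _
  have hE0 : 0 ≤ FluidPDE.Torus.scalarL2Sq θ₀ := FluidPDE.Torus.scalarL2Sq_nonneg _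
  have hB0 : 0 ≤ B := (abs_nonneg _).trans (hB 0)
  -- absolute constants: smooth-step bounds and the two V symbol sockets
  obtain ⟨C, hC0, hC₁, hC₂⟩ := Literature.Analysis.Calculus.exists_abs_deriv_and_deriv_deriv_smoothTransition_le
  obtain ⟨CMV, hCMV0, hMV⟩ := exists_fibre_data_symProdM_V
  obtain ⟨CSV, hCSV0, hSV⟩ := exists_fibre_data_symProdS_V_sq
  -- the majorants (uniform constants)
  obtain ⟨AX, hAX0, hAX⟩ := exists_errX_bound (γ := P.γ) (γb := P.γ ^ 2 + 29 / 20) (L₀ := L₀) (δ₀ := P.δ₀) (C₁ := C)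
    (C₂ := C) (Co := CMV) (Cn := CSV) (Mb := Real.sqrt (2 * Real.log (2000 * ((1 + P.γ) ^ 2 + 1)))) (r := (P.γ ^ 2 - 3)) (ρ := ((P.γ ^ 2 - 5 / 2) / (1 + 1 / 250) ^ 2 - 1 / (2 * (1 + 1 / 250) * L₀)))
    (Θ₀ := Real.sqrt (max (16 / ((P.γ ^ 2 - 5 / 2) / (1 + 1 / 250) ^ 2 - 1 / (2 * (1 + 1 / 250) * L₀))) (1 / 2))) (c := (3 * P.γ + 5) * L₀ / 1000) hγ0 hγb hL0 hδ₀ hC0 hC0 hCMV0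
    hCSV0 hMb0 (by positivity) hr1.le hρ0 hρr2 hΘpos.le hΘlt1.le hΘ16 hΘhalf hG2
  obtain ⟨AY, hAY0, hAY⟩ := exists_errY_bound (γb := P.γ ^ 2 + 29 / 20) (L₀ := L₀) (δ₀ := P.δ₀) (C₁ := C) (C₂ := C)
    (Cn := CSV) (Mb := Real.sqrt (2 * Real.log (2000 * ((1 + P.γ) ^ 2 + 1)))) (ρ := ((P.γ ^ 2 - 5 / 2) / (1 + 1 / 250) ^ 2 - 1 / (2 * (1 + 1 / 250) * L₀))) (Θ₀ := Real.sqrt (max (16 / ((P.γ ^ 2 - 5 / 2) / (1 + 1 / 250) ^ 2 - 1 / (2 * (1 + 1 / 250) * L₀))) (1 / 2)))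
    (E₀ := FluidPDE.Torus.scalarL2Sq θ₀) (B := B) hγb hL0 hδ₀ hC0 hC0 hCSV0 hMb0 hρ0
    hΘpos.le hΘlt1.le hΘ16 hΘhalf hE0 hB0
  obtain ⟨K₀, hK₀0, hK₀⟩ := exists_pow_mul_pow_le hΘpos.le hΘθ 2
  refine ⟨AX * Real.sqrt (FluidPDE.Torus.scalarL2Sq θ₀) * K₀, AY * K₀, by positivity, by positivity, ?_⟩
  intro κ hκ w hw h0 j _ hj
  -- the phase data
  have hκ0 : 0 < κ := hκ.1
  have hκr : κ * (P.γ ^ 2 - 3) ^ (2 * j) ≤ 1 := kappa_mul_rate_pow_le_one hr1 hκ0 hκ.2 hj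
  have hNj : P.N j ≠ 0 := N_ne_zero P hN₀ hρN j
  have hLj := L_pos hγ hγ' hL₀ j
  have hLj1 := L_pos hγ hγ' hL₀ (j + 1)
  have hwj := w_pos hγ hγ' hL₀ j
  have hwj1 := w_pos hγ hγ' hL₀ (j + 1)
  have hRj := R_pos (γ := P.γ) hL₀ j
  have hRj1 := R_pos (γ := P.γ) hL₀ (j + 1)
  have hR'j := R'_pos hγ hγ' hL₀ j
  have hbV := bV_pos hγ hγ' hL₀ j
  have hB' : ∀ x, |w 0 x| ≤ B := fun x => by rw [h0]; exact hB x
  -- the envelope radius against the cut-off width: `(R′_j + w_j)·ε_j ≤ (3γ+5)L₀/1000`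
  have hRw0 : 0 ≤ ((1 + P.γ) * (2 * L₀ * ((1 + P.γ) ^ 2 + 1) ^ j + L₀ * ((P.γ ^ 2 - 5 / 2) / (1 + 1 / 250) ^ 2 - 1 / (2 * (1 + 1 / 250) * L₀)) ^ j / (20 * P.γ * (1 + 1 / 250))) + 1 / 2) + L₀ * ((P.γ ^ 2 - 5 / 2) / (1 + 1 / 250) ^ 2 - 1 / (2 * (1 + 1 / 250) * L₀)) ^ j / (20 * P.γ * (1 + 1 / 250)) := by positivity
  have hRw : (((1 + P.γ) * (2 * L₀ * ((1 + P.γ) ^ 2 + 1) ^ j + L₀ * ((P.γ ^ 2 - 5 / 2) / (1 + 1 / 250) ^ 2 - 1 / (2 * (1 + 1 / 250) * L₀)) ^ j / (20 * P.γ * (1 + 1 / 250))) + 1 / 2) + L₀ * ((P.γ ^ 2 - 5 / 2) / (1 + 1 / 250) ^ 2 - 1 / (2 * (1 + 1 / 250) * L₀)) ^ j / (20 * P.γ * (1 + 1 / 250))) * (1 / (1000 * ((1 + P.γ) ^ 2 + 1) ^ j)) ≤ (3 * P.γ + 5) * L₀ / 1000 := by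
    have hGj : 0 < ((1 + P.γ) ^ 2 + 1) ^ j := by positivity
    have hGj1 : 1 ≤ ((1 + P.γ) ^ 2 + 1) ^ j := one_le_pow₀ hG1
    have hρG : ((P.γ ^ 2 - 5 / 2) / (1 + 1 / 250) ^ 2 - 1 / (2 * (1 + 1 / 250) * L₀)) ^ j ≤ ((1 + P.γ) ^ 2 + 1) ^ j := pow_le_pow_left₀ hρ0.le (rho_le_Gamma hγ hL₀) j
    have hw1 : L₀ * ((P.γ ^ 2 - 5 / 2) / (1 + 1 / 250) ^ 2 - 1 / (2 * (1 + 1 / 250) * L₀)) ^ j / (20 * P.γ * (1 + 1 / 250)) ≤ L₀ * ((1 + P.γ) ^ 2 + 1) ^ j := by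
      rw [div_le_iff₀ (by positivity)]
      have h1 : L₀ * ((P.γ ^ 2 - 5 / 2) / (1 + 1 / 250) ^ 2 - 1 / (2 * (1 + 1 / 250) * L₀)) ^ j ≤ L₀ * ((1 + P.γ) ^ 2 + 1) ^ j := mul_le_mul_of_nonneg_left hρG hL0.le
      have h2 : L₀ * ((1 + P.γ) ^ 2 + 1) ^ j ≤ L₀ * ((1 + P.γ) ^ 2 + 1) ^ j * (20 * P.γ * (1 + 1 / 250)) :=
        le_mul_of_one_le_right (by positivity) (by linarith only [hγ])
      exact h1.trans h2
    have hhalf : (1 : ℝ) / 2 ≤ L₀ * ((1 + P.γ) ^ 2 + 1) ^ j := by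
      have : L₀ ≤ L₀ * ((1 + P.γ) ^ 2 + 1) ^ j := le_mul_of_one_le_right hL0.le hGj1
      linarith only [this, hL₀]
    have hsum : ((1 + P.γ) * (2 * L₀ * ((1 + P.γ) ^ 2 + 1) ^ j + L₀ * ((P.γ ^ 2 - 5 / 2) / (1 + 1 / 250) ^ 2 - 1 / (2 * (1 + 1 / 250) * L₀)) ^ j / (20 * P.γ * (1 + 1 / 250))) + 1 / 2) + L₀ * ((P.γ ^ 2 - 5 / 2) / (1 + 1 / 250) ^ 2 - 1 / (2 * (1 + 1 / 250) * L₀)) ^ j / (20 * P.γ * (1 + 1 / 250)) ≤ (3 * P.γ + 5) * L₀ * ((1 + P.γ) ^ 2 + 1) ^ j := by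
      have h3 : 2 * L₀ * ((1 + P.γ) ^ 2 + 1) ^ j + L₀ * ((P.γ ^ 2 - 5 / 2) / (1 + 1 / 250) ^ 2 - 1 / (2 * (1 + 1 / 250) * L₀)) ^ j / (20 * P.γ * (1 + 1 / 250)) ≤ 3 * L₀ * ((1 + P.γ) ^ 2 + 1) ^ j := by linarith only [hw1]
      have h4 : (1 + P.γ) * (2 * L₀ * ((1 + P.γ) ^ 2 + 1) ^ j + L₀ * ((P.γ ^ 2 - 5 / 2) / (1 + 1 / 250) ^ 2 - 1 / (2 * (1 + 1 / 250) * L₀)) ^ j / (20 * P.γ * (1 + 1 / 250))) ≤ (1 + P.γ) * (3 * L₀ * ((1 + P.γ) ^ 2 + 1) ^ j) :=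
        mul_le_mul_of_nonneg_left h3 (by linarith)
      nlinarith only [h4, hw1, hhalf]
    calc (((1 + P.γ) * (2 * L₀ * ((1 + P.γ) ^ 2 + 1) ^ j + L₀ * ((P.γ ^ 2 - 5 / 2) / (1 + 1 / 250) ^ 2 - 1 / (2 * (1 + 1 / 250) * L₀)) ^ j / (20 * P.γ * (1 + 1 / 250))) + 1 / 2) + L₀ * ((P.γ ^ 2 - 5 / 2) / (1 + 1 / 250) ^ 2 - 1 / (2 * (1 + 1 / 250) * L₀)) ^ j / (20 * P.γ * (1 + 1 / 250))) * (1 / (1000 * ((1 + P.γ) ^ 2 + 1) ^ j))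
        ≤ ((3 * P.γ + 5) * L₀ * ((1 + P.γ) ^ 2 + 1) ^ j) * (1 / (1000 * ((1 + P.γ) ^ 2 + 1) ^ j)) := mul_le_mul_of_nonneg_right hsum (by positivity)
      _ = (3 * P.γ + 5) * L₀ / 1000 := by field_simp
  -- the two majorants at phase `j`
  have hX := hAX j κ (Real.sqrt (2 * Real.log (2000 * ((1 + P.γ) ^ 2 + 1) ^ j)))
    (((1 + P.γ) * (2 * L₀ * ((1 + P.γ) ^ 2 + 1) ^ j + L₀ * ((P.γ ^ 2 - 5 / 2) / (1 + 1 / 250) ^ 2 - 1 / (2 * (1 + 1 / 250) * L₀)) ^ j / (20 * P.γ * (1 + 1 / 250))) + 1 / 2) + L₀ * ((P.γ ^ 2 - 5 / 2) / (1 + 1 / 250) ^ 2 - 1 / (2 * (1 + 1 / 250) * L₀)) ^ j / (20 * P.γ * (1 + 1 / 250))) (tHalf j) _ _ hκ0.le hκr (M_nonneg P.γ j)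
    (M_le P.γ j) (M_sq_le P.γ j) hRw0 hRw (tHalf_pos j).le (tHalf_le_one j) rfl rfl
  have hY := hAY j (Real.sqrt (2 * Real.log (2000 * ((1 + P.γ) ^ 2 + 1) ^ j))) _ (M_nonneg P.γ j) (M_le P.γ j)
    (M_sq_le P.γ j) rfl
  have hΦK := hK₀ j
  -- the concrete V half-slot at phase `j`
  have hstep := cascade_ledger_step_V_concrete P hγ1 hδ₀ hd0 j hNj
    (ε := 1 / (1000 * ((1 + P.γ) ^ 2 + 1) ^ j)) (M := Real.sqrt (2 * Real.log (2000 * ((1 + P.γ) ^ 2 + 1) ^ j)))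
    (C₁ := C) (C₂ := C) (eps_pos P.γ j) (eps_le_sixth P.γ j) (gamma_mul_eps_le hγ hγ' j) (one_le_M P.γ j)
    (exp_neg_M_sq_le P.γ j) (M_mul_delta_le P hγ hγ' hδ₀ hδ₀' hd j) hC₁ hC₂
    (c₁ := 2 * C * (Real.sqrt (2 * Real.log (2000 * ((1 + P.γ) ^ 2 + 1) ^ j)) + 4) * (2 * Real.pi * P.N j / P.δ j))
    (c₂ := (4 * C * (Real.sqrt (2 * Real.log (2000 * ((1 + P.γ) ^ 2 + 1) ^ j)) + 4) ^ 2 + 2 * C * (2 * Real.sqrt (2 * Real.log (2000 * ((1 + P.γ) ^ 2 + 1) ^ j)) ^ 2 + 33)) * (2 * Real.pi * P.N j / P.δ j) ^ 2)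
    rfl rfl
    (εs := 1 / 250) (εa := 1 / 20) (a := 13 / 10) (a₂ := 29 / 20) (L := L₀ * ((P.γ ^ 2 - 5 / 2) / (1 + 1 / 250) ^ 2 - 1 / (2 * (1 + 1 / 250) * L₀)) ^ j) (R' := ((1 + P.γ) * (2 * L₀ * ((1 + P.γ) ^ 2 + 1) ^ j + L₀ * ((P.γ ^ 2 - 5 / 2) / (1 + 1 / 250) ^ 2 - 1 / (2 * (1 + 1 / 250) * L₀)) ^ j / (20 * P.γ * (1 + 1 / 250))) + 1 / 2)) (w' := L₀ * ((P.γ ^ 2 - 5 / 2) / (1 + 1 / 250) ^ 2 - 1 / (2 * (1 + 1 / 250) * L₀)) ^ j / (20 * P.γ * (1 + 1 / 250)))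
    (L' := L₀ * ((P.γ ^ 2 - 5 / 2) / (1 + 1 / 250) ^ 2 - 1 / (2 * (1 + 1 / 250) * L₀)) ^ (j + 1)) (R'' := 2 * L₀ * ((1 + P.γ) ^ 2 + 1) ^ (j + 1)) (w'' := L₀ * ((P.γ ^ 2 - 5 / 2) / (1 + 1 / 250) ^ 2 - 1 / (2 * (1 + 1 / 250) * L₀)) ^ (j + 1) / (20 * P.γ * (1 + 1 / 250))) (b := L₀ * ((P.γ ^ 2 - 5 / 2) / (1 + 1 / 250) ^ 2 - 1 / (2 * (1 + 1 / 250) * L₀)) ^ j / (20 * (P.γ ^ 2 + 29 / 20) * (1 + 1 / 250)))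
    (by norm_num) (by norm_num) (by norm_num) hLj hR'j hwj hLj1 hwj1 hbV (aperture_V hγ)
    (cone_condition_V hγ hγ' hL₀ j) (L_succ_le hγ hγ' hL₀ j) (envelope_V hγ hγ' hL₀ j) hCMV0 hCSV0
    (fun n' => hMV (by norm_num) (by norm_num) (by norm_num) (div_pos hLj (by norm_num)) hR'j hwj hbV
      (bV_le_radial hγ hγ' hL₀ j) (bV_mul_le hγ j) (bV_le_w hγ hγ' hL₀ j) n')
    (fun n' t₀ => hSV (by norm_num) (by norm_num) (by norm_num) hLj1 hRj1 hwj1 hbV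
      (bV_le_radial_succ hγ hγ' hL₀ j) (bV_mul_a_le hγ hγ' hL₀ j) (bV_le_w_succ hγ hγ' hL₀ j) n' t₀)
    hκ0.le hw hB'
  have htH0 : 0 < tHalf j := tHalf_pos j
  have hδj : 0 < P.δ j := P.δ_pos hδ₀ hd0 j
  have hEw : 0 ≤ FluidPDE.Torus.scalarL2Sq (w 0) := FluidPDE.Torus.scalarL2Sq_nonneg _
  refine ⟨_, _, ?_, ?_, ?_, ?_, hstep.trans (le_of_eq (add_assoc _ _ _))⟩
  · clear hstep hX hY hΦK hRw hRw0 hw hB' hB hAX hAY hK₀ hSV hMV hC₁ hC₂ hΘ16 hΘhalf hΘθ hθ1 hθ0 hΘpos hΘlt1 hρr2 hrρ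
      hκr hj hLj1 hwj1 hRj1 hR'j hRj hwj hr22 hρ16 hG2 hG1 hMb0 hκ h0
    positivity
  · clear hstep hY hRw hRw0 hw hB' hSV hMV hC₁ hC₂ hAX hAY hK₀
    rw [h0, Lambda_eq P hN₀ hρN hd hδ₀ j]
    calc _ ≤ AX * (((j : ℝ) + 1) ^ 2 * Real.sqrt (max (16 / ((P.γ ^ 2 - 5 / 2) / (1 + 1 / 250) ^ 2 - 1 / (2 * (1 + 1 / 250) * L₀))) (1 / 2)) ^ j) * Real.sqrt (FluidPDE.Torus.scalarL2Sq θ₀) :=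
          mul_le_mul_of_nonneg_right hX (Real.sqrt_nonneg _)
      _ ≤ AX * (K₀ * Real.sqrt (Real.sqrt (max (16 / ((P.γ ^ 2 - 5 / 2) / (1 + 1 / 250) ^ 2 - 1 / (2 * (1 + 1 / 250) * L₀))) (1 / 2))) ^ j) * Real.sqrt (FluidPDE.Torus.scalarL2Sq θ₀) := by gcongr
      _ = _ := by ring
  · clear hstep hX hY hΦK hRw hRw0 hw hB' hB hAX hAY hK₀ hSV hMV hC₁ hC₂ hΘ16 hΘhalf hΘθ hθ1 hθ0 hΘpos hΘlt1 hρr2 hrρ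
      hκr hj hLj1 hwj1 hRj1 hR'j hRj hwj hr22 hρ16 hG2 hG1 hMb0 hκ h0
    positivity
  · clear hstep hX hRw hRw0 hw hB' hSV hMV hC₁ hC₂ hAX hAY hK₀
    rw [h0, Lambda_eq P hN₀ hρN hd hδ₀ j, delta_eq P hd j]
    calc _ ≤ AY * (((j : ℝ) + 1) ^ 2 * Real.sqrt (max (16 / ((P.γ ^ 2 - 5 / 2) / (1 + 1 / 250) ^ 2 - 1 / (2 * (1 + 1 / 250) * L₀))) (1 / 2)) ^ j) := hY
      _ ≤ AY * (K₀ * Real.sqrt (Real.sqrt (max (16 / ((P.γ ^ 2 - 5 / 2) / (1 + 1 / 250) ^ 2 - 1 / (2 * (1 + 1 / 250) * L₀))) (1 / 2))) ^ j) := by gcongr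
      _ = _ := by ring

end Cascade

end Summit.AnomalousDissipation.AnomalousDissipation.Theorems.SawtoothPulseCascade.K1Ledger
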